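import Summits.QuantumFields.BalabanUV.T4Continuum.Support.NE9Lemma1RemainderSpeciesAdditive
import Summits.QuantumFields.BalabanUV.T4Continuum.Support.NE9Lemma1RemainderSpeciesEnd

/-!
# NE9Lemma1RemainderSpeciesEndAdditive — the NE9 END (`…_compProj` face) AT THE DISPLAYED SPECIES with the piece-additivity
# binder S3 DISCHARGED: the owner's `NE9Lemma1RemainderSpeciesEnd.termSize_ne9_and_fadingMemory_rem_compProj` (p213009)
# re-derived BY NAME with `hA : PieceAdditiveOn (analyticClass D.R) D.toC` replaced by the direction-regularity binders of
# `NE9Lemma1RemainderSpeciesAdditive.pieceAdditiveOn_rem` (crew row (w16)) — the channel side of that face is then KERNEL for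
# the species up to O1-type data (cell `pub-balaban`, T4-DAG §2 node U3 / §6 NE9; unit b2b-balaban-t4-ne9-formalise-leaf-08 gen 4;
# bookkeeping corollary — nothing of the parents is modified, no END re-wired; the d-currency counterpart is leaf-07's
# `NE9LinSizeEndRemSpeciesAdd`, landed independently)

HONEST FRAMING (T4-DAG PAGE 1).  Rung (B)+1 of the FINITE-VOLUME T⁴ programme — existence and uniqueness of the ε → 0 limit
of gauge-invariant observables on a FIXED finite torus; NOT infinite volume, NOT a mass gap, NOT the Clay problem.  NE9
(`T4OutputRate.NE9` ∧ `FadingMemory`) is a cell NEW ESTIMATE, NOT PRINTED, NOT discharged here («NE9 ⇐ the named binders»);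
spine 0/9; 0/18 skeleton leaves instantiated on Bałaban's objects — the species is the owner's FORM-level `RemData.toC`, whose
identification with Bałaban's (1.23)/(1.33) pieces is O-NE9-1 (NODE O), NOT claimed.  HONEST DEPENDENCY (cell line, verbatim):
continuum YM on T⁴ ⇐ BetaPertH ∧ nine spine estimates (0/9 proved); BetaPertH ⇐ (D1) ∧ (D4) ∧ CAP+tail; G-an2-4 gates asym, D1
and NE2/3/4.  `FlowStep.BetaPertH`, (B), (B^μ) do not occur.  [II] = [Balaban1988RG2Cluster] (CMP **116**) is quoted for TYPES
only (ABSOLUTE RULE: nothing printed in the audited series is asserted).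

WHAT IS PROVED (kernel, one `exact`-composition BY NAME).  The parent face displays, on the channel side, the additivity of the
(1.23)-pieces in the old term on the analytic class, `hA : PieceAdditiveOn (analyticClass D.R) D.toC` (S3's piece-level half).
`NE9Lemma1RemainderSpeciesAdditive.pieceAdditiveOn_rem` (p213082) proves it from `0 < κ₁`, `0 < r_k` (both inside
`RemData.Admissible`) and the DIRECTION-REGULARITY binders — `hdirC`: the contour directions `D.dir k s y a b x t s σ` are jointly
continuous in (t, s, σ); `hdirR`: they lie inside the analyticity ball of radius `R_X` (TYPE [II] (1.21)/(1.23) p. 7: the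
directions *"(tζ̃_□ + t_□ζ_□)𝐇_k(σ(Y₀), B′)"* are built from the s-interpolated operators and the terms are analytic on
*"𝔘^c_{k+1}(□₀,(1+2β)α₀,(1+2β)α₁,α₀)"* — instantiation-side, O1-adjacent).  So `termSize_ne9_and_fadingMemory_rem_compProj_
of_dirRegular` is the owner's END-M `…_compProj` face at the species with `hA` ↦ `hdirC`, `hdirR`: all three channel binders of
that face (S3-additivity, S3-sum, S5) are KERNEL for the species on any marginal-free `MF ⊆ analyticClass D.R`; displayed remain
`RemData.Admissible` (printed TYPE: domain inclusion (I.3.36), radii, G1), `LevelCountsG` ((1.26)–(1.28)), the direction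
regularity, and the face's own projection / activity / KP / geometry / read-out binders, verbatim.  Conclusion VERBATIM the
parent's.  DISGUISE TEST: the new binders concern ONE direction family of ONE term (continuity and a norm bound) — not NE9.

References (TYPES only): [Balaban1988RG2Cluster] T. Bałaban, *Renormalization group approach to lattice gauge field theories.
II*, Commun. Math. Phys. **116** (1988) 1–22, (1.21)–(1.25) p. 7 (render `b2b-balaban-ref1/pages/1988-cmp116-rg-II-cluster/…-
p007-x2.png` re-read as image by this seat, 2026-08-20), (1.33)–(1.36) p. 9.  Summits-side NEW work (LEAN PLACEMENT RULE);
imports the two parents BY NAME; modifies nothing; 0 def; 0 sorry; `[folklore]` bookkeeping.  Value = one END face with one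
displayed binder fewer, NOT summit progress.
-/

noncomputable section

namespace Summit.QuantumFields.BalabanUV.T4Continuum.NE9Lemma1RemainderSpeciesEndAdditive

open scoped BigOperators
open Literature.Probability.LatticeModels
open Literature.MathematicalPhysics.QuantumFieldTheory.Balaban1983to89
open Literature.MathematicalPhysics.QuantumFieldTheory.Balaban1983to89.T4OutputRate
open Literature.MathematicalPhysics.QuantumFieldTheory.Balaban1983to89.T4HistoryLipschitzRecursion
open Literature.MathematicalPhysics.QuantumFieldTheory.Balaban1983to89.T4HistoryLipschitzOuter
open Literature.MathematicalPhysics.QuantumFieldTheory.Balaban1983to89.T4HistoryLipschitzActivity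
open Literature.MathematicalPhysics.QuantumFieldTheory.Balaban1983to89.T4HistoryLipschitzActivity (ClusterGeom)
open Literature.MathematicalPhysics.QuantumFieldTheory.Balaban1983to89.T4HistoryLipschitzSegment
open Summit.QuantumFields.BalabanUV.T4Continuum.NE9Lemma1Counting
open Summit.QuantumFields.BalabanUV.T4Continuum.NE9Lemma1Gain
open Summit.QuantumFields.BalabanUV.T4Continuum.NE9Lemma1PieceClass
open Summit.QuantumFields.BalabanUV.T4Continuum.NE9ComplexEncoding (doubleCarriers)
open Summit.QuantumFields.BalabanUV.T4Continuum.NE9Lemma1RemainderSpecies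
open Summit.QuantumFields.BalabanUV.T4Continuum.NE9Lemma1RemainderSpeciesAdditive (pieceAdditiveOn_rem)
open Summit.QuantumFields.BalabanUV.T4Continuum.NE9Lemma1RemainderSpeciesEnd (termSize_ne9_and_fadingMemory_rem_compProj)
open Summit.QuantumFields.BalabanUV.T4Continuum.NE9MarginalProjection
open Summit.QuantumFields.BalabanUV.T4Continuum.NE9MarginalProjectionEnd

/-! ## The owner's `…_compProj` face at the species, S3 discharged -/

section CompProj

variable {C₀ : Carriers} {E : Type} [NormedAddCommGroup E] [NormedSpace ℂ E] {ι α β γ δ : Type} [DecidableEq δ]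

/-- **THE NE9 END (`…_compProj` face) AT THE DISPLAYED SPECIES WITH S3 DISCHARGED** — the owner's
`NE9Lemma1RemainderSpeciesEnd.termSize_ne9_and_fadingMemory_rem_compProj` (p213009) with its displayed binder
`hA : PieceAdditiveOn (analyticClass D.R) D.toC` SUPPLIED by `NE9Lemma1RemainderSpeciesAdditive.pieceAdditiveOn_rem` BY NAME
(crew row (w16)): in its place the face now displays the two DIRECTION-REGULARITY binders `hdirC` (the contour directions are
jointly continuous in (t, s, σ)) and `hdirR` (they lie inside the analyticity ball of radius R_X) — TYPE [II] (1.21)/(1.23) p. 7,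
instantiation-side; `κ₁ ≥ 1` and `r_k > 0` are read from `hD : D.Admissible`.  Every other binder and the conclusion VERBATIM
the owner's face (all three channel binders S3-additivity / S3-sum / S5 now KERNEL for the species on MF ⊆ the analytic class).
[cite: Balaban1988RG2Cluster, (1.21)-(1.25) p.7, (1.33)-(1.36) p.9] -/
theorem termSize_ne9_and_fadingMemory_rem_compProj_of_dirRegular (G : ClusterGeom (doubleCarriers C₀)) {Pot : Type*}
    [NormedAddCommGroup Pot] [NormedSpace ℂ Pot] {D : RemData C₀ E ι α β γ δ} {ℓg : ℕ → ℕ → ℝ} {cdir d0 O1 cQ : ℝ}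
    {Ef : Functional (doubleCarriers C₀) E} {W : Set (ℕ → ℝ)}
    {Adm MF : Set (E → (doubleCarriers C₀).Dom → ℝ)}
    {P : (E → (doubleCarriers C₀).Dom → ℝ) → (E → (doubleCarriers C₀).Dom → ℝ)}
    {Ψ : ℕ → ℝ → (ι → ℝ) → E → (doubleCarriers C₀).Dom → ℝ} {act : ℕ → ℝ → E → Pot → G.P → ℂ} {𝒜 : ℕ → Set Pot}
    {n : ℕ → ℝ → E → G.P → ℝ} {lip clip : ℕ → ℝ} {a d : G.P → ℝ} {δv : (doubleCarriers C₀).Dom → ℝ}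
    {κ B lipbar clipbar qTbar ω c : ℝ} {qT p₀ N : ℕ → ℝ}
    -- the species' binders (printed TYPE + numerals) and the class
    (hD : D.Admissible ℓg cdir d0) (hℓg : ∀ k j, 0 ≤ ℓg k j)
    (hL : LevelCountsG D.toC.frame κ D.κ₁ O1 cQ (fun k j => ℓg k j ^ 5) (agePow ω)) (hO1 : 0 ≤ O1) (hcQ : 0 ≤ cQ)
    (hMF : MF ⊆ analyticClass D.R)
    -- S3 DISCHARGED (crew row (w16)): in place of `hA : PieceAdditiveOn (analyticClass D.R) D.toC`, the DIRECTION-REGULARITY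
    -- binders of `NE9Lemma1RemainderSpeciesAdditive.pieceAdditiveOn_rem` (TYPE [II] (1.21)/(1.23) p. 7; κ₁ ≥ 1, r_k > 0 from `hD`)
    (hdirC : ∀ k s y a b x, Continuous fun p : ℂ × (δ → ℝ) × (δ → ℂ) => D.dir k s y a b x p.1 p.2.1 p.2.2)
    (hdirR : ∀ k s y a b x t s' σ', ‖D.dir k s y a b x t s' σ'‖ < D.R x.1)
    -- the face's binders, verbatim
    (ρ : ℕ → (ι → ℝ) → Pot) (U₀ : E) (explZ : ℕ → E → (doubleCarriers C₀).Dom → ℝ) (h0 : ScaleZeroFree Ef W)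
    (hAdm : AdmissibleTerms Ef W Adm) (hres : AdmRestrict Adm)
    (hPadd : ProjAdditive Adm P) (hPcomm : ProjScaleComm Adm P) (hPinto : ProjInto Adm MF P) (hPsize : ProjSize Adm P κ c)
    (hc : 0 ≤ c)
    (hfac : Factorises Ef W (compProj (cpieceChannel D.toC) P) Ψ) (hclip0 : ∀ k, 0 ≤ clip k)
    (hCup : ∀ g ∈ W, ∀ g' ∈ W, ∀ (k : ℕ) (U : E) (X : (doubleCarriers C₀).Dom), (doubleCarriers C₀).scale X = k + 1 →
      ∀ Q ∈ 𝒜 k, ∀ γ' ∈ G.vol X,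
      ‖act k (g k) U Q γ'‖ ≤ n k (g' k) U γ' ∧
        ‖act k (g k) U Q γ' - act k (g' k) U Q γ'‖ ≤ clip k * |g k - g' k| * n k (g' k) U γ')
    (hqT0 : ∀ k, 0 ≤ qT k)
    (hTcup : ∀ g ∈ W, ∀ g' ∈ W, ∀ (k : ℕ) (y : ι),
      |compProj (cpieceChannel D.toC) P k g (Ef g) y - compProj (cpieceChannel D.toC) P k g' (Ef g) y| ≤
        weightOf D.toC.frame D.κ₁ d0 O1 (KpOf D cdir) k y * (qT k * |g k - g' k|))
    (hreprV : ∀ (k : ℕ) (s : ℝ) (Q : ι → ℝ) (U : E) (X : (doubleCarriers C₀).Dom),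
      Ψ k s Q U X = (G.newTerm act k s U X (ρ k Q)).re - (G.newTerm act k s U₀ X (ρ k Q)).re + explZ k U X)
    (hclipb : ∀ k, clip k ≤ clipbar) (hqTb : ∀ k, qT k ≤ qTbar)
    (hK : TwoPointKP G W act 𝒜 n lip a d) (hdec : G.DecayExtract δv d) (hpin : G.PinBudget a δv (fun _ => B) κ)
    (hρ : ∀ (k : ℕ) (Q Q' : ι → ℝ) (M : ℝ),
      (∀ y, |Q y - Q' y| ≤ weightOf D.toC.frame D.κ₁ d0 O1 (KpOf D cdir) k y * M) → ‖ρ k Q - ρ k Q'‖ ≤ M)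
    (hexplZ : ∀ (k : ℕ) (U : E) (X : (doubleCarriers C₀).Dom), (doubleCarriers C₀).scale X = k + 1 →
      |explZ k U X| ≤ Real.exp (-(κ * (doubleCarriers C₀).d X)) * p₀ k)
    (hbase : ∀ g ∈ W, ∀ (U : E) (X : (doubleCarriers C₀).Dom), (doubleCarriers C₀).scale X = 0 →
      |Ef g U X| ≤ Real.exp (-(κ * (doubleCarriers C₀).d X)) * N 0)
    (hNsucc : ∀ j, p₀ j + 2 * B ≤ N (j + 1)) (hNnn : ∀ j, 0 ≤ N j)
    (hbox : ∀ (k : ℕ) (Q : ι → ℝ), (∀ y, |Q y| ≤ weightOf D.toC.frame D.κ₁ d0 O1 (KpOf D cdir) k y *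
      sizeRadius (fun k j => (1 + c) * tauOfG cQ (agePow ω) k j) N k) → ρ k Q ∈ 𝒜 k)
    (hB : 0 ≤ B) (hlipb : ∀ k, lip k ≤ lipbar) (hω : 0 ≤ ω)
    (hpos : 0 < ω + 8 * lipbar * B * ((1 + c) * cQ)) :
    TermSize Ef W κ N ∧
      NE9 Ef W κ (prodModuli (8 * clipbar * B + 8 * lipbar * B * qTbar)
        fun _ => ω + 8 * lipbar * B * ((1 + c) * cQ)) ∧
        FadingMemory ((8 * clipbar * B + 8 * lipbar * B * qTbar) / (ω + 8 * lipbar * B * ((1 + c) * cQ)))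
          (ω + 8 * lipbar * B * ((1 + c) * cQ))
          (prodModuli (8 * clipbar * B + 8 * lipbar * B * qTbar) fun _ => ω + 8 * lipbar * B * ((1 + c) * cQ)) :=
  termSize_ne9_and_fadingMemory_rem_compProj G hD hℓg hL hO1 hcQ hMF
    (pieceAdditiveOn_rem D (lt_of_lt_of_le one_pos hD.κ₁_ge) hD.r_pos hdirC hdirR) ρ U₀ explZ h0 hAdm hres hPadd hPcomm
    hPinto hPsize hc hfac hclip0 hCup hqT0 hTcup hreprV hclipb hqTb hK hdec hpin hρ hexplZ hbase hNsucc hNnn hbox hB hlipb hω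
    hpos

end CompProj

end Summit.QuantumFields.BalabanUV.T4Continuum.NE9Lemma1RemainderSpeciesEndAdditive
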